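import Mathlib
import HarnessLib

/-!
# Real 3×3 matrix families with only real eigenvalues spanned by four or more matrices (Oshime 1991)

Two NAMED FACTS (D-0014, statements only), requested by route ValiantsHypothesis/PermanentalCones
(crux `HyperbolicVPShadow`, item `stmt-ValiantsHypothesis-8655`, lead c4 skeleton stub
`stub_oshime_dim5_facts`): the dimension bound of the `N = 3` layer of that crux — an
irreducible, not simultaneously symmetrisable linear space of real `3 × 3` matrices with only real
eigenvalues has dimension `≤ 4` (identity included) — is exactly the content of the two
parameter-free theorems below, taken from Y. Oshime's classification of hyperbolic `3 × 3`
systems with real constant coefficients (the matrix families `⟨A₁, …, Aₙ⟩` of the first-order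
systems `∂u/∂t = Σ Aᵢ ∂u/∂xᵢ`).

* `Oshime1991a_thm51` — Y. Oshime, *Canonical forms of 3×3 strongly hyperbolic systems with real
  constant coefficients*, J. Math. Kyoto Univ. 31 (1991) 937–982, **Theorem 5.1** (= Theorem 7.1
  of the summary), verbatim: "Suppose that a nondegenerate 3×3 matrix family `⟨A₁, A₂, …, Aₙ⟩`
  (`n ≥ 4`) is real-diagonalizable. Then `⟨A₁, A₂, …, Aₙ⟩` is simultaneously symmetrizable."
* `Oshime1991b_thm61` — Y. Oshime, *On the canonical forms of 3×3 non-diagonalizable hyperbolic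
  systems with real constant coefficients*, ibid. 983–1021, **Theorem 6.1**, verbatim: "Suppose
  that a nondegenerate non-diagonalizable 3×3 matrix family `⟨A₁, A₂, …, Aₙ⟩` (`n ≥ 4`) has only
  real eigenvalues. Then it is equivalent to a subfamily of (6.1), (6.1'), (6.2) or (6.2')",
  combined with **Lemma 3.2** (ibid.; (6.1), (6.2) reproduce (3.1), (3.2)), verbatim: "If
  `⟨A₁, A₂, …, Aₙ⟩` is equivalent to a subfamily of either (3.1) or (3.2) then all members of
  `⟨A₁, A₂, …, Aₙ⟩` have a common right eigenvector. Similarly, if `⟨A₁, A₂, …, Aₙ⟩` is equivalent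
  to a subfamily of (3.1') or (3.2') then all of its members have a common left eigenvector."
  (The families (3.1), (3.2) are the five-dimensional families of matrices `(* * *; 0 * *; 0 * *)`
  with symmetric resp. upper-triangular lower-right block, (3.1'), (3.2') their transposes; only
  the eigenvector consequence is vendored, so they need not be transcribed.)

Printed definitions (paper I §2 = paper II §2, "Throughout this paper, we consider only real
square (actually 3×3) matrices and their linear combinations with real coefficients"):
* Def. 2.1: the *matrix family* `⟨A₁, …, Aₙ⟩` spanned by `A₁, …, Aₙ` is the set of all real linear
  combinations `A(ξ) = Σ ξᵢAᵢ`, `ξ ∈ ℝⁿ`;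
* I Def. 2.2 / II Def. 2.3: *real-diagonalizable* — for every `A(ξ)` there exists a nonsingular
  (real) matrix `S(ξ)` such that `S(ξ)⁻¹A(ξ)S(ξ)` is a real diagonal matrix; *non-diagonalizable* —
  some `A(ξ)` is not similar to any diagonal matrix;
* II Def. 2.2: `⟨A₁, …, Aₙ⟩` *has only real eigenvalues* if each of its members has only real
  eigenvalues;
* I Def. 2.5: *simultaneously symmetrizable* — there exists a nonsingular (real) matrix `T` such
  that all `T⁻¹AᵢT` (`i = 1, …, n`) are symmetric;
* I Def. 2.8 / II Def. 2.5: *nondegenerate* — `I, A₁, A₂, …, Aₙ` are linearly independent over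
  the reals.

## Rendering
* `A : Fin n → Matrix (Fin 3) (Fin 3) ℝ`, `4 ≤ n`; nondegenerate =
  `LinearIndependent ℝ (Fin.cons 1 A)` (the family `(I, A₁, …, Aₙ)` indexed by `Fin (n+1)`).
* real-diagonalizable = `∀ ξ, ∃ S, IsUnit S ∧ ∃ D : Fin 3 → ℝ, S⁻¹ * (Σ ξᵢ • Aᵢ) * S = diagonal D`
  (real `S`, real diagonal); non-diagonalizable = its negation (all matrices being real, "not
  similar to any diagonal matrix" is over `ℝ`; for a matrix with only real eigenvalues real and
  complex diagonalisability agree anyway).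
* only real eigenvalues = every complex root `z` of `det (A(ξ) − z·I)` is real, written with
  `Matrix.map (algebraMap ℝ ℂ)` as in the requesting route's items.
* simultaneously symmetrizable = `∃ T, IsUnit T ∧ ∀ i, (T⁻¹ * A i * T).IsSymm`.
* common right eigenvector of all members = a non-zero `v` with `Aᵢ v = μᵢ v` for every generator
  (equivalent, by linearity, to being an eigenvector of every member); common left eigenvector =
  `Matrix.vecMul w (A i) = μᵢ • w`.
Theorem 6.1's conclusion is vendored only through Lemma 3.2 (common right/left eigenvector), the
form the requesting crux uses (reducibility); the canonical families themselves and the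
parametrised classification theorems (I Thms 4.7, 7.2–7.5; II Thms 6.2, 6.3) are deliberately NOT
vendored here.

## References
* [Oshime1991a] Y. Oshime, J. Math. Kyoto Univ. 31 (1991) 937–982: §2 (Defs 2.1, 2.2, 2.5, 2.8),
  Thm 5.1 (p. 961), Thm 7.1 (p. 979).
* [Oshime1991b] Y. Oshime, J. Math. Kyoto Univ. 31 (1991) 983–1021: §2 (Defs 2.1–2.5), (3.1)–(3.2')
  and Lemma 3.2 (pp. 986–987), Thm 6.1 (p. 1019).
-/

noncomputable section

open Matrix
open scoped BigOperators

namespace Literature.LinearAlgebra.Matrix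

/-- **Oshime 1991 (I), Theorem 5.1** (= Theorem 7.1): "Suppose that a nondegenerate 3×3 matrix
family `⟨A₁, A₂, …, Aₙ⟩` (`n ≥ 4`) is real-diagonalizable. Then `⟨A₁, A₂, …, Aₙ⟩` is simultaneously
symmetrizable." Dictionary (ibid. §2): nondegenerate = `I, A₁, …, Aₙ` linearly independent over
`ℝ`; real-diagonalizable = every real combination `Σ ξᵢAᵢ` is `S D S⁻¹` with `S` real invertible and
`D` real diagonal; simultaneously symmetrizable = one real invertible `T` makes every `T⁻¹AᵢT`
symmetric. Grounds the dimension bound of the `N = 3` layer of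
`Summit.ValiantsHypothesis.ValiantsHypothesis.Theses.PermanentalCones.HyperbolicVPShadow`
(crux workfile `Cruxes/HyperbolicVPShadow/Lines/birth.lean`, stub `stub_oshime_dim5_facts`).
[cite: Oshime1991a, Thm 5.1 (= Thm 7.1), with Defs 2.1, 2.2, 2.5, 2.8] -/
def Oshime1991a_thm51 : Prop :=
  ∀ (n : ℕ) (A : Fin n → Matrix (Fin 3) (Fin 3) ℝ), 4 ≤ n →
    LinearIndependent ℝ (Fin.cons (1 : Matrix (Fin 3) (Fin 3) ℝ) A) →
    (∀ ξ : Fin n → ℝ, ∃ S : Matrix (Fin 3) (Fin 3) ℝ, IsUnit S ∧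
      ∃ D : Fin 3 → ℝ, S⁻¹ * (∑ i, ξ i • A i) * S = Matrix.diagonal D) →
    ∃ T : Matrix (Fin 3) (Fin 3) ℝ, IsUnit T ∧ ∀ i, (T⁻¹ * A i * T).IsSymm

/-- **Oshime 1991 (II), Theorem 6.1 with Lemma 3.2**: "Suppose that a nondegenerate
non-diagonalizable 3×3 matrix family `⟨A₁, A₂, …, Aₙ⟩` (`n ≥ 4`) has only real eigenvalues. Then
it is equivalent to a subfamily of (6.1), (6.1'), (6.2) or (6.2')" (Thm 6.1), and a family
equivalent to a subfamily of (6.1) = (3.1) or (6.2) = (3.2) has a common right eigenvector, one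
equivalent to a subfamily of their transposes (3.1'), (3.2') a common left eigenvector (Lemma 3.2).
Dictionary (ibid. §2): nondegenerate = `I, A₁, …, Aₙ` linearly independent; only real eigenvalues =
every member `Σ ξᵢAᵢ` has only real (complex) eigenvalues; non-diagonalizable = some member is not
similar (over `ℝ`) to a real diagonal matrix. Grounds the dimension bound of the `N = 3` layer of
`Summit.ValiantsHypothesis.ValiantsHypothesis.Theses.PermanentalCones.HyperbolicVPShadow`
(crux workfile `Cruxes/HyperbolicVPShadow/Lines/birth.lean`, stub `stub_oshime_dim5_facts`).
[cite: Oshime1991b, Thm 6.1 and Lemma 3.2, with Defs 2.1–2.5] -/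
def Oshime1991b_thm61 : Prop :=
  ∀ (n : ℕ) (A : Fin n → Matrix (Fin 3) (Fin 3) ℝ), 4 ≤ n →
    LinearIndependent ℝ (Fin.cons (1 : Matrix (Fin 3) (Fin 3) ℝ) A) →
    (∀ (ξ : Fin n → ℝ) (z : ℂ),
      ((∑ i, ξ i • A i).map (algebraMap ℝ ℂ) - z • (1 : Matrix (Fin 3) (Fin 3) ℂ)).det = 0 →
        z.im = 0) →
    (¬ ∀ ξ : Fin n → ℝ, ∃ S : Matrix (Fin 3) (Fin 3) ℝ, IsUnit S ∧
      ∃ D : Fin 3 → ℝ, S⁻¹ * (∑ i, ξ i • A i) * S = Matrix.diagonal D) →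
    (∃ v : Fin 3 → ℝ, v ≠ 0 ∧ ∀ i, ∃ μ : ℝ, (A i).mulVec v = μ • v) ∨
    (∃ w : Fin 3 → ℝ, w ≠ 0 ∧ ∀ i, ∃ μ : ℝ, Matrix.vecMul w (A i) = μ • w)

end Literature.LinearAlgebra.Matrix
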